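import Summits.AnomalousDissipation.AnomalousDissipation.Theorems.SawtoothPulseCascadeK1LocalisedCascadeKHTransportCoeff
import Summits.AnomalousDissipation.AnomalousDissipation.Theorems.SawtoothPulseCascadeK1LocalisedCascadeKHBlochPoly

/-!
# K2 lane (route-2 `SawtoothPulseCascade`, crux dir `K1LocalisedCascade`): the ENERGY-FORM TRANSPORT BOUND by duality — a sawtooth shear of strain `θ` amplifies the windowed lattice energy of any row profile by at most `θ² + 2`, column by column (E6 far-row schema, sub-lemma L-i-b in full: multi-row, K-, shell- and class-uniform; A27-7)

Helper file of the K2 lane (ACL item stmt-AnomalousDissipation-19491). In p4's `vTransport`/`hTransport` (crux copy of `K2ConeSketch`) a profile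
`g(x) = Σ_{m∈S} z(m) e^{2πi(α+m)x}` of one column (line wavenumber `b = β+n ≠ 0`) is multiplied by the unimodular Lipschitz transport phase
`u(x) = e^{−2πibθ·tri(x)}` and re-expanded; the column's level-energy weights are `1/((α+m)² + b²)`. THE BOUND (`transport_energy_duality`): for every
finite output window `S′`, `Σ_{m′∈S′} |⟨g·u, e_{m′}⟩|² / ((α+m′)² + b²) ≤ (θ² + 2) · Σ_{m∈S} |z(m)|² / ((α+m)² + b²)`.
PROOF (1-D duality, no locality): with `a(m′) = ⟨gu, e_{m′}⟩/((α+m′)²+b²)` and `ψ = Σ_{S′} a e_{m′}`, the left side is `L = ⟨gu, ψ⟩ = ⟨g, ūψ⟩ =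
Σ_{m∈S} z(m)·conj((ūψ)^(m))` (tree `…KHBlochPoly`), so `L² ≤ (Σ_S |z|²/W)·(Σ_S W|(ūψ)^|²)`, `W = (α+m)²+b²` (Cauchy–Schwarz); and the analytic core
`weighted_coeff_sum_conjTransport_le`: `Σ_S W |(ūψ)^(m)|² ≤ (θ²+2)·Σ_{S′} W|a|² = (θ²+2)·L` — Bessel for `ūψ` and for its piecewise derivative (integration
by parts on the three affine pieces of `tri`, the kink boundary terms cancelling by continuity and Bloch periodicity), `|(ūψ)′| ≤ |ψ′| + 2π|bθ||ψ|`
pointwise, Young with `t = θ²+1`, `∫|ψ|² = Σ|a|²`, `∫|ψ′|² = 4π²Σ(α+m′)²|a|²`. Hence `L ≤ (θ²+2)·Σ_S |z|²/W`: this is `‖ζ∘Φ‖_{Ḣ⁻¹} ≤ ‖DΦ⁻¹‖_∞‖ζ‖_{Ḣ⁻¹}` for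
the shear `Φ`, on the lattice with 1-D Fourier analysis only; measured worst case at θ = 8 ≈ 2.6 (job j327934), bound 66. No definitions; nothing about
the crux by name. [cite: ElgindiLissMattingly2025, §1 (H_α, V_α)] [problem: turb]
-/
-- `Summit.<Summit>.<Problem>`: single-conjunct summit, the duplicate namespace segment is deliberate.
set_option linter.dupNamespace false

noncomputable section

namespace Summit.AnomalousDissipation.AnomalousDissipation.Theorems.SawtoothPulseCascade.K2PhaseBudget

open Finset MeasureTheory intervalIntegral Set Literature.Analysis.FluidPDE.SawtoothCascade

/-- `conj u(x) = e^{+2πibθ·tri(x)}`. [folklore] -/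
theorem conj_transportPhase' (b θ x : ℝ) :
    (starRingEnd ℂ) (Complex.exp (-((2 * Real.pi * b * θ * triWave x : ℝ) : ℂ) * Complex.I)) =
      Complex.exp (((2 * Real.pi * b * θ * triWave x : ℝ) : ℂ) * Complex.I) := by
  rw [← Complex.exp_conj, map_mul, map_neg, Complex.conj_ofReal, Complex.conj_I]
  congr 1
  ring

/-- `‖e^{+2πibθ·tri(x)}‖ = 1`. [folklore] -/
theorem norm_conjTransportPhase' (b θ x : ℝ) : ‖Complex.exp (((2 * Real.pi * b * θ * triWave x : ℝ) : ℂ) * Complex.I)‖ = 1 :=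
  Complex.norm_exp_ofReal_mul_I _

/-- On a piece where `tri(x) = σx + τ`, the function `x ↦ e^{2πibθ(σx+τ)i}·ψ(x)` (`ψ` a Bloch polynomial) has the derivative
`e^{…}·(2πbθσ·i)·ψ + e^{…}·ψ′`. [folklore] -/
theorem hasDerivAt_piece (b θ σ τ α : ℝ) (S : Finset ℤ) (a : ℤ → ℂ) (x : ℝ) :
    HasDerivAt (fun x : ℝ => Complex.exp (((2 * Real.pi * b * θ * (σ * x + τ) : ℝ) : ℂ) * Complex.I) *
        ∑ m ∈ S, a m * Complex.exp ((2 * Real.pi * (α + m) * x : ℝ) * Complex.I))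
      (Complex.exp (((2 * Real.pi * b * θ * (σ * x + τ) : ℝ) : ℂ) * Complex.I) * ((((2 * Real.pi * b * θ * σ : ℝ) : ℂ) * Complex.I) *
          ∑ m ∈ S, a m * Complex.exp ((2 * Real.pi * (α + m) * x : ℝ) * Complex.I)) +
        Complex.exp (((2 * Real.pi * b * θ * (σ * x + τ) : ℝ) : ℂ) * Complex.I) *
          ∑ m ∈ S, a m * (Complex.exp ((2 * Real.pi * (α + m) * x : ℝ) * Complex.I) * (((2 * Real.pi * (α + m) : ℝ) : ℂ) * Complex.I))) x := by
  have h0 : HasDerivAt (fun x : ℝ => 2 * Real.pi * b * θ * (σ * x + τ)) (2 * Real.pi * b * θ * σ) x := by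
    have := ((hasDerivAt_id x).const_mul σ).add_const τ |>.const_mul (2 * Real.pi * b * θ)
    simpa using this
  have h1 : HasDerivAt (fun x : ℝ => ((2 * Real.pi * b * θ * (σ * x + τ) : ℝ) : ℂ) * Complex.I) (((2 * Real.pi * b * θ * σ : ℝ) : ℂ) * Complex.I) x :=
    h0.ofReal_comp.mul_const Complex.I
  have h2 : HasDerivAt (fun x : ℝ => Complex.exp (((2 * Real.pi * b * θ * (σ * x + τ) : ℝ) : ℂ) * Complex.I))
      (Complex.exp (((2 * Real.pi * b * θ * (σ * x + τ) : ℝ) : ℂ) * Complex.I) * (((2 * Real.pi * b * θ * σ : ℝ) : ℂ) * Complex.I)) x := h1.cexp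
  have h3 : HasDerivAt (fun y : ℝ => Complex.exp (((2 * Real.pi * b * θ * (σ * y + τ) : ℝ) : ℂ) * Complex.I) * ∑ m ∈ S, a m * Complex.exp ((2 * Real.pi * (α + m) * y : ℝ) * Complex.I))
      (Complex.exp (((2 * Real.pi * b * θ * (σ * x + τ) : ℝ) : ℂ) * Complex.I) * (((2 * Real.pi * b * θ * σ : ℝ) : ℂ) * Complex.I) * ∑ m ∈ S, a m * Complex.exp ((2 * Real.pi * (α + m) * x : ℝ) * Complex.I) + Complex.exp (((2 * Real.pi * b * θ * (σ * x + τ) : ℝ) : ℂ) * Complex.I) * ∑ m ∈ S, a m * (Complex.exp ((2 * Real.pi * (α + m) * x : ℝ) * Complex.I) * (((2 * Real.pi * (α + m) : ℝ) : ℂ) * Complex.I))) x :=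
    h2.mul (hasDerivAt_blochPoly α S a x)
  exact h3.congr_deriv (by ring)

/-- Integration by parts on one affine piece: `∫_{y₁}^{y₂} f_P′·ē_m = f_P(y₂)ē_m(y₂) − f_P(y₁)ē_m(y₁) + 2πi(α+m)·∫_{y₁}^{y₂} f_P·ē_m`. [folklore] -/
theorem integral_piece_deriv_mul_conjExp (b θ σ τ α : ℝ) (S : Finset ℤ) (a : ℤ → ℂ) (m : ℤ) (y₁ y₂ : ℝ) :
    ∫ x in y₁..y₂, (Complex.exp (((2 * Real.pi * b * θ * (σ * x + τ) : ℝ) : ℂ) * Complex.I) * ((((2 * Real.pi * b * θ * σ : ℝ) : ℂ) * Complex.I) * ∑ m' ∈ S, a m' * Complex.exp ((2 * Real.pi * (α + m') * x : ℝ) * Complex.I)) + Complex.exp (((2 * Real.pi * b * θ * (σ * x + τ) : ℝ) : ℂ) * Complex.I) * ∑ m' ∈ S, a m' * (Complex.exp ((2 * Real.pi * (α + m') * x : ℝ) * Complex.I) * (((2 * Real.pi * (α + m') : ℝ) : ℂ) * Complex.I))) * Complex.exp (-(2 * Real.pi * (α + m) * x : ℝ) * Complex.I) =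
      (Complex.exp (((2 * Real.pi * b * θ * (σ * y₂ + τ) : ℝ) : ℂ) * Complex.I) * ∑ m' ∈ S, a m' * Complex.exp ((2 * Real.pi * (α + m') * y₂ : ℝ) * Complex.I)) * Complex.exp (-(2 * Real.pi * (α + m) * y₂ : ℝ) * Complex.I) - (Complex.exp (((2 * Real.pi * b * θ * (σ * y₁ + τ) : ℝ) : ℂ) * Complex.I) * ∑ m' ∈ S, a m' * Complex.exp ((2 * Real.pi * (α + m') * y₁ : ℝ) * Complex.I)) * Complex.exp (-(2 * Real.pi * (α + m) * y₁ : ℝ) * Complex.I) +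
      (((2 * Real.pi * (α + m) : ℝ) : ℂ) * Complex.I) * ∫ x in y₁..y₂, (Complex.exp (((2 * Real.pi * b * θ * (σ * x + τ) : ℝ) : ℂ) * Complex.I) * ∑ m' ∈ S, a m' * Complex.exp ((2 * Real.pi * (α + m') * x : ℝ) * Complex.I)) * Complex.exp (-(2 * Real.pi * (α + m) * x : ℝ) * Complex.I) := by
  have hv : ∀ x : ℝ, HasDerivAt (fun x : ℝ => Complex.exp (-(2 * Real.pi * (α + m) * x : ℝ) * Complex.I)) (Complex.exp (-(2 * Real.pi * (α + m) * x : ℝ) * Complex.I) * (-(((2 * Real.pi * (α + m) : ℝ) : ℂ) * Complex.I))) x := by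
    intro x
    have h0 : HasDerivAt (fun x : ℝ => 2 * Real.pi * (α + m) * x) (2 * Real.pi * (α + m)) x := by
      simpa using (hasDerivAt_id x).const_mul (2 * Real.pi * (α + m))
    have h1 : HasDerivAt (fun x : ℝ => -(((2 * Real.pi * (α + m) * x : ℝ) : ℂ)) * Complex.I) (-(((2 * Real.pi * (α + m) : ℝ) : ℂ)) * Complex.I) x :=
      h0.ofReal_comp.neg.mul_const Complex.I
    have h2 : HasDerivAt (fun x : ℝ => Complex.exp (-(((2 * Real.pi * (α + m) * x : ℝ) : ℂ)) * Complex.I))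
        (Complex.exp (-(((2 * Real.pi * (α + m) * x : ℝ) : ℂ)) * Complex.I) * (-(((2 * Real.pi * (α + m) : ℝ) : ℂ)) * Complex.I)) x := h1.cexp
    convert h2 using 1
    ring
  have hu := fun x (_ : x ∈ uIcc y₁ y₂) => hasDerivAt_piece b θ σ τ α S a x
  have hv' := fun x (_ : x ∈ uIcc y₁ y₂) => hv x
  have hcUd : Continuous fun x : ℝ => (Complex.exp (((2 * Real.pi * b * θ * (σ * x + τ) : ℝ) : ℂ) * Complex.I) * ((((2 * Real.pi * b * θ * σ : ℝ) : ℂ) * Complex.I) * ∑ m' ∈ S, a m' * Complex.exp ((2 * Real.pi * (α + m') * x : ℝ) * Complex.I)) + Complex.exp (((2 * Real.pi * b * θ * (σ * x + τ) : ℝ) : ℂ) * Complex.I) * ∑ m' ∈ S, a m' * (Complex.exp ((2 * Real.pi * (α + m') * x : ℝ) * Complex.I) * (((2 * Real.pi * (α + m') : ℝ) : ℂ) * Complex.I))) := by fun_prop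
  have hcU : Continuous fun x : ℝ => (Complex.exp (((2 * Real.pi * b * θ * (σ * x + τ) : ℝ) : ℂ) * Complex.I) * ∑ m' ∈ S, a m' * Complex.exp ((2 * Real.pi * (α + m') * x : ℝ) * Complex.I)) := by fun_prop
  have hcV : Continuous fun x : ℝ => Complex.exp (-(2 * Real.pi * (α + m) * x : ℝ) * Complex.I) := by fun_prop
  have hcVd : Continuous fun x : ℝ => (Complex.exp (-(2 * Real.pi * (α + m) * x : ℝ) * Complex.I) * (-(((2 * Real.pi * (α + m) : ℝ) : ℂ) * Complex.I))) := by fun_prop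
  have hibp := intervalIntegral.integral_deriv_mul_eq_sub hu hv' (hcUd.intervalIntegrable _ _) (hcVd.intervalIntegrable _ _)
  have e1 : ∫ x in y₁..y₂, ((Complex.exp (((2 * Real.pi * b * θ * (σ * x + τ) : ℝ) : ℂ) * Complex.I) * ((((2 * Real.pi * b * θ * σ : ℝ) : ℂ) * Complex.I) * ∑ m' ∈ S, a m' * Complex.exp ((2 * Real.pi * (α + m') * x : ℝ) * Complex.I)) + Complex.exp (((2 * Real.pi * b * θ * (σ * x + τ) : ℝ) : ℂ) * Complex.I) * ∑ m' ∈ S, a m' * (Complex.exp ((2 * Real.pi * (α + m') * x : ℝ) * Complex.I) * (((2 * Real.pi * (α + m') : ℝ) : ℂ) * Complex.I))) * Complex.exp (-(2 * Real.pi * (α + m) * x : ℝ) * Complex.I) + (Complex.exp (((2 * Real.pi * b * θ * (σ * x + τ) : ℝ) : ℂ) * Complex.I) * ∑ m' ∈ S, a m' * Complex.exp ((2 * Real.pi * (α + m') * x : ℝ) * Complex.I)) * (Complex.exp (-(2 * Real.pi * (α + m) * x : ℝ) * Complex.I) * (-(((2 * Real.pi * (α + m) : ℝ) : ℂ) * Complex.I))))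 =
      (∫ x in y₁..y₂, (Complex.exp (((2 * Real.pi * b * θ * (σ * x + τ) : ℝ) : ℂ) * Complex.I) * ((((2 * Real.pi * b * θ * σ : ℝ) : ℂ) * Complex.I) * ∑ m' ∈ S, a m' * Complex.exp ((2 * Real.pi * (α + m') * x : ℝ) * Complex.I)) + Complex.exp (((2 * Real.pi * b * θ * (σ * x + τ) : ℝ) : ℂ) * Complex.I) * ∑ m' ∈ S, a m' * (Complex.exp ((2 * Real.pi * (α + m') * x : ℝ) * Complex.I) * (((2 * Real.pi * (α + m') : ℝ) : ℂ) * Complex.I))) * Complex.exp (-(2 * Real.pi * (α + m) * x : ℝ) * Complex.I)) + ∫ x in y₁..y₂, (Complex.exp (((2 * Real.pi * b * θ * (σ * x + τ) : ℝ) : ℂ) * Complex.I) * ∑ m' ∈ S, a m' * Complex.exp ((2 * Real.pi * (α + m') * x : ℝ) * Complex.I)) * (Complex.exp (-(2 * Real.pi * (α + m) * x : ℝ) * Complex.I) * (-(((2 * Real.pi * (α + m) : ℝ) : ℂ) * Complex.I))) :=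
    intervalIntegral.integral_add ((hcUd.mul hcV).intervalIntegrable _ _) ((hcU.mul hcVd).intervalIntegrable _ _)
  have e2 : ∫ x in y₁..y₂, (Complex.exp (((2 * Real.pi * b * θ * (σ * x + τ) : ℝ) : ℂ) * Complex.I) * ∑ m' ∈ S, a m' * Complex.exp ((2 * Real.pi * (α + m') * x : ℝ) * Complex.I)) * (Complex.exp (-(2 * Real.pi * (α + m) * x : ℝ) * Complex.I) * (-(((2 * Real.pi * (α + m) : ℝ) : ℂ) * Complex.I))) = -(((2 * Real.pi * (α + m) : ℝ) : ℂ) * Complex.I) * ∫ x in y₁..y₂, (Complex.exp (((2 * Real.pi * b * θ * (σ * x + τ) : ℝ) : ℂ) * Complex.I) * ∑ m' ∈ S, a m' * Complex.exp ((2 * Real.pi * (α + m') * x : ℝ) * Complex.I)) * Complex.exp (-(2 * Real.pi * (α + m) * x : ℝ) * Complex.I) := by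
    rw [← intervalIntegral.integral_const_mul]
    refine intervalIntegral.integral_congr fun x _ => ?_
    ring
  rw [e1, e2] at hibp
  linear_combination hibp

/-- `e^{2πi(α+m′)x}·e^{−2πi(α+m)x} = e^{2πi(m′−m)x}`. [folklore] -/
theorem blochExp_mul_conjExp (α : ℝ) (m' m : ℤ) (x : ℝ) :
    Complex.exp ((2 * Real.pi * (α + m') * x : ℝ) * Complex.I) * Complex.exp (-(2 * Real.pi * (α + m) * x : ℝ) * Complex.I) =
      Complex.exp (((2 * Real.pi * ((m' - m : ℤ)) * x : ℝ) : ℂ) * Complex.I) := by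
  rw [← Complex.exp_add]; congr 1; push_cast; ring

/-- Bloch periodicity: `ψ(½)ē_m(½) = ψ(−½)ē_m(−½)`. [folklore] -/
theorem blochPoly_mul_conjExp_half (α : ℝ) (S' : Finset ℤ) (a : ℤ → ℂ) (m : ℤ) :
    (∑ m' ∈ S', a m' * Complex.exp ((2 * Real.pi * (α + m') * (1 / 2 : ℝ) : ℝ) * Complex.I)) * Complex.exp (-(2 * Real.pi * (α + m) * (1 / 2 : ℝ) : ℝ) * Complex.I) =
      (∑ m' ∈ S', a m' * Complex.exp ((2 * Real.pi * (α + m') * (-(1 / 2) : ℝ) : ℝ) * Complex.I)) * Complex.exp (-(2 * Real.pi * (α + m) * (-(1 / 2) : ℝ) : ℝ) * Complex.I) := by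
  rw [Finset.sum_mul, Finset.sum_mul]
  refine Finset.sum_congr rfl fun m' _ => ?_
  rw [mul_assoc (a m'), mul_assoc (a m'), blochExp_mul_conjExp, blochExp_mul_conjExp]
  congr 1
  rw [show (((2 * Real.pi * ((m' - m : ℤ)) * (1 / 2 : ℝ) : ℝ) : ℂ) * Complex.I) =
      (((2 * Real.pi * ((m' - m : ℤ)) * (-(1 / 2) : ℝ) : ℝ) : ℂ) * Complex.I) + ((m' - m : ℤ) : ℂ) * (2 * Real.pi * Complex.I) by push_cast; ring,
    Complex.exp_add, Complex.exp_int_mul_two_pi_mul_I, mul_one]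

/-- Young's inequality in the form used below: `(p+q)² ≤ (1+1/t)p² + (1+t)q²` (`t > 0`). [folklore] -/
theorem add_sq_le_young {p q t : ℝ} (ht : 0 < t) : (p + q) ^ 2 ≤ (1 + 1 / t) * p ^ 2 + (1 + t) * q ^ 2 := by
  have e : (1 + 1 / t) * p ^ 2 + (1 + t) * q ^ 2 = (p + q) ^ 2 + (p - t * q) ^ 2 / t := by
    field_simp
    ring
  rw [e]
  have : 0 ≤ (p - t * q) ^ 2 / t := by positivity
  linarith

/-- A bounded measurable function is interval integrable (Lebesgue measure). [folklore] -/
theorem intervalIntegrable_of_bounded_measurable {E : Type*} [NormedAddCommGroup E] [MeasurableSpace E] [BorelSpace E]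
    [SecondCountableTopology E] {φ : ℝ → E} (hφ : Measurable φ) {C : ℝ}
    (hC : ∀ x, ‖φ x‖ ≤ C) (u v : ℝ) : IntervalIntegrable φ volume u v := by
  rw [intervalIntegrable_iff]
  refine Measure.integrableOn_of_bounded ?_ hφ.aestronglyMeasurable (ae_of_all _ hC)
  simp only [Set.uIoc, Real.volume_Ioc]
  exact ENNReal.ofReal_ne_top

/-- **The analytic core.** For a Bloch polynomial `ψ = Σ_{m′∈S′} a(m′)e^{2πi(α+m′)x}`, the function `f = e^{+2πibθ·tri}·ψ` satisfies, for every finite `S`,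
`Σ_{m∈S} ((α+m)²+b²)·|f̂(m)|² ≤ (θ²+2)·Σ_{m′∈S′} ((α+m′)²+b²)·|a(m′)|²` (Bessel for `f` and for its piecewise derivative, IBP on the three affine pieces of
`tri`, `|f′| ≤ |ψ′| + 2π|bθ||ψ|`, Young with `t = θ²+1`). [cite: ElgindiLissMattingly2025, §1 (H_α, V_α)] -/
theorem weighted_coeff_sum_conjTransport_le (α b θ : ℝ) (S S' : Finset ℤ) (a : ℤ → ℂ) :
    ∑ m ∈ S, ((α + m) ^ 2 + b ^ 2) * ‖∫ x in (-(1 / 2) : ℝ)..(1 / 2 : ℝ), (Complex.exp (((2 * Real.pi * b * θ * triWave x : ℝ) : ℂ) * Complex.I) * (∑ m' ∈ S', a m' * Complex.exp ((2 * Real.pi * (α + m') * x : ℝ) * Complex.I))) * Complex.exp (-(2 * Real.pi * (α + m) * x : ℝ) * Complex.I)‖ ^ 2 ≤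
      (θ ^ 2 + 2) * ∑ m' ∈ S', ((α + m') ^ 2 + b ^ 2) * ‖a m'‖ ^ 2 := by
  -- the Bloch polynomial, its derivative polynomial, their `L²` norms and pointwise sizes
  have hψc : Continuous fun x : ℝ => (∑ m' ∈ S', a m' * Complex.exp ((2 * Real.pi * (α + m') * x : ℝ) * Complex.I)) := continuous_blochPoly α S' a
  have nψ : ∫ x in (-(1 / 2) : ℝ)..(1 / 2 : ℝ), ‖(∑ m' ∈ S', a m' * Complex.exp ((2 * Real.pi * (α + m') * x : ℝ) * Complex.I))‖ ^ 2 = ∑ m' ∈ S', ‖a m'‖ ^ 2 := integral_norm_sq_blochPoly α S' a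
  have nψ' : ∫ x in (-(1 / 2) : ℝ)..(1 / 2 : ℝ), ‖(∑ m' ∈ S', a m' * (Complex.exp ((2 * Real.pi * (α + m') * x : ℝ) * Complex.I) * (((2 * Real.pi * (α + m') : ℝ) : ℂ) * Complex.I)))‖ ^ 2 = ∑ m' ∈ S', (2 * Real.pi * (α + m')) ^ 2 * ‖a m'‖ ^ 2 := by
    have h := integral_norm_sq_blochPoly α S' (fun m' => a m' * ((((2 * Real.pi * (α + m') : ℝ) : ℂ) * Complex.I)))
    have e : ∀ x : ℝ, (∑ m' ∈ S', a m' * (Complex.exp ((2 * Real.pi * (α + m') * x : ℝ) * Complex.I) * (((2 * Real.pi * (α + m') : ℝ) : ℂ) * Complex.I))) =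
        ∑ m' ∈ S', (a m' * ((((2 * Real.pi * (α + m') : ℝ) : ℂ) * Complex.I))) * Complex.exp ((2 * Real.pi * (α + m') * x : ℝ) * Complex.I) :=
      fun x => Finset.sum_congr rfl fun m' _ => by ring
    simp_rw [e]
    rw [h]
    refine Finset.sum_congr rfl fun m' _ => ?_
    rw [norm_mul, norm_mul, Complex.norm_real, Complex.norm_I, mul_one, Real.norm_eq_abs, mul_pow, sq_abs]; ring
  have bψ : ∀ x : ℝ, ‖(∑ m' ∈ S', a m' * Complex.exp ((2 * Real.pi * (α + m') * x : ℝ) * Complex.I))‖ ≤ ∑ m' ∈ S', ‖a m'‖ := fun x =>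
    (norm_sum_le _ _).trans (le_of_eq (Finset.sum_congr rfl fun m' _ => by rw [norm_mul, Complex.norm_exp_ofReal_mul_I, mul_one]))
  have bψ' : ∀ x : ℝ, ‖(∑ m' ∈ S', a m' * (Complex.exp ((2 * Real.pi * (α + m') * x : ℝ) * Complex.I) * (((2 * Real.pi * (α + m') : ℝ) : ℂ) * Complex.I)))‖ ≤ ∑ m' ∈ S', ‖a m'‖ * (2 * Real.pi * |α + m'|) := fun x =>
    (norm_sum_le _ _).trans (le_of_eq (Finset.sum_congr rfl fun m' _ => by
      rw [norm_mul, norm_mul, Complex.norm_exp_ofReal_mul_I, one_mul, norm_mul, Complex.norm_real, Complex.norm_I, mul_one, Real.norm_eq_abs,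
        abs_mul, abs_of_pos Real.two_pi_pos]))
  set A₁ : ℝ := ∑ m' ∈ S', ‖a m'‖ with hA₁
  set A₂ : ℝ := ∑ m' ∈ S', ‖a m'‖ * (2 * Real.pi * |α + m'|) with hA₂
  set κ : ℝ := 2 * Real.pi * |b| * |θ| with hκ
  have hκ0 : 0 ≤ κ := by positivity
  -- `f = e^{+2πibθ tri} ψ`
  have hfc : Continuous fun x : ℝ => (Complex.exp (((2 * Real.pi * b * θ * triWave x : ℝ) : ℂ) * Complex.I) * (∑ m' ∈ S', a m' * Complex.exp ((2 * Real.pi * (α + m') * x : ℝ) * Complex.I))) := by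
    have := continuous_triWave'
    fun_prop
  have nf : ∀ x : ℝ, ‖(Complex.exp (((2 * Real.pi * b * θ * triWave x : ℝ) : ℂ) * Complex.I) * (∑ m' ∈ S', a m' * Complex.exp ((2 * Real.pi * (α + m') * x : ℝ) * Complex.I)))‖ = ‖(∑ m' ∈ S', a m' * Complex.exp ((2 * Real.pi * (α + m') * x : ℝ) * Complex.I))‖ := fun x => by
    rw [norm_mul, norm_conjTransportPhase', one_mul]
  -- the three pieces of the derivative: continuity and pointwise size
  have cTR : Continuous fun x : ℝ => (Complex.exp (((2 * Real.pi * b * θ * ((-1) * x + (-(1 / 2))) : ℝ) : ℂ) * Complex.I) * ((((2 * Real.pi * b * θ * (-1) : ℝ) : ℂ) * Complex.I) * (∑ m' ∈ S', a m' * Complex.exp ((2 * Real.pi * (α + m') * x : ℝ) * Complex.I))) + Complex.exp (((2 * Real.pi * b * θ * ((-1) * x + (-(1 / 2))) : ℝ) : ℂ) * Complex.I) * (∑ m' ∈ S', a m' * (Complex.exp ((2 * Real.pi * (α + m') * x : ℝ) * Complex.I) * (((2 * Real.pi * (α + m') : ℝ) : ℂ) * Complex.I)))) := by fun_prop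
  have cCE : Continuous fun x : ℝ => (Complex.exp (((2 * Real.pi * b * θ * (1 * x + 0) : ℝ) : ℂ) * Complex.I) * ((((2 * Real.pi * b * θ * 1 : ℝ) : ℂ) * Complex.I) * (∑ m' ∈ S', a m' * Complex.exp ((2 * Real.pi * (α + m') * x : ℝ) * Complex.I))) + Complex.exp (((2 * Real.pi * b * θ * (1 * x + 0) : ℝ) : ℂ) * Complex.I) * (∑ m' ∈ S', a m' * (Complex.exp ((2 * Real.pi * (α + m') * x : ℝ) * Complex.I) * (((2 * Real.pi * (α + m') : ℝ) : ℂ) * Complex.I)))) := by fun_prop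
  have cCR : Continuous fun x : ℝ => (Complex.exp (((2 * Real.pi * b * θ * ((-1) * x + (1 / 2)) : ℝ) : ℂ) * Complex.I) * ((((2 * Real.pi * b * θ * (-1) : ℝ) : ℂ) * Complex.I) * (∑ m' ∈ S', a m' * Complex.exp ((2 * Real.pi * (α + m') * x : ℝ) * Complex.I))) + Complex.exp (((2 * Real.pi * b * θ * ((-1) * x + (1 / 2)) : ℝ) : ℂ) * Complex.I) * (∑ m' ∈ S', a m' * (Complex.exp ((2 * Real.pi * (α + m') * x : ℝ) * Complex.I) * (((2 * Real.pi * (α + m') : ℝ) : ℂ) * Complex.I)))) := by fun_prop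
  have bH : ∀ σ τ x : ℝ, |σ| = 1 → ‖Complex.exp (((2 * Real.pi * b * θ * (σ * x + τ) : ℝ) : ℂ) * Complex.I) * ((((2 * Real.pi * b * θ * σ : ℝ) : ℂ) * Complex.I) * (∑ m' ∈ S', a m' * Complex.exp ((2 * Real.pi * (α + m') * x : ℝ) * Complex.I))) + Complex.exp (((2 * Real.pi * b * θ * (σ * x + τ) : ℝ) : ℂ) * Complex.I) * (∑ m' ∈ S', a m' * (Complex.exp ((2 * Real.pi * (α + m') * x : ℝ) * Complex.I) * (((2 * Real.pi * (α + m') : ℝ) : ℂ) * Complex.I)))‖ ≤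
      κ * ‖(∑ m' ∈ S', a m' * Complex.exp ((2 * Real.pi * (α + m') * x : ℝ) * Complex.I))‖ + ‖(∑ m' ∈ S', a m' * (Complex.exp ((2 * Real.pi * (α + m') * x : ℝ) * Complex.I) * (((2 * Real.pi * (α + m') : ℝ) : ℂ) * Complex.I)))‖ := by
    intro σ τ x hσ
    refine (norm_add_le _ _).trans (le_of_eq ?_)
    simp only [norm_mul, Complex.norm_exp_ofReal_mul_I, one_mul, Complex.norm_real, Complex.norm_I, mul_one, Real.norm_eq_abs,
      abs_two, abs_of_pos Real.pi_pos, hσ, hκ]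
  -- the piecewise derivative `h`
  obtain ⟨h, hh⟩ : ∃ h : ℝ → ℂ, h = fun x => (if x ≤ -(1 / 4 : ℝ) then (Complex.exp (((2 * Real.pi * b * θ * ((-1) * x + (-(1 / 2))) : ℝ) : ℂ) * Complex.I) * ((((2 * Real.pi * b * θ * (-1) : ℝ) : ℂ) * Complex.I) * (∑ m' ∈ S', a m' * Complex.exp ((2 * Real.pi * (α + m') * x : ℝ) * Complex.I))) + Complex.exp (((2 * Real.pi * b * θ * ((-1) * x + (-(1 / 2))) : ℝ) : ℂ) * Complex.I) * (∑ m' ∈ S', a m' * (Complex.exp ((2 * Real.pi * (α + m') * x : ℝ) * Complex.I) * (((2 * Real.pi * (α + m') : ℝ) : ℂ) * Complex.I)))) else if x ≤ (1 / 4 : ℝ) then (Complex.exp (((2 * Real.pi * b * θ * (1 * x + 0) : ℝ) : ℂ) * Complex.I) * ((((2 * Real.pi * b * θ * 1 : ℝ) : ℂ) * Complex.I) * (∑ m' ∈ S', a m' * Complex.exp ((2 * Real.pi * (α + m') * x : ℝ) * Complex.I))) + Complex.exp (((2 * Real.pi * b * θ * (1 * x + 0) : ℝ) : ℂ) * Complex.I)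 * (∑ m' ∈ S', a m' * (Complex.exp ((2 * Real.pi * (α + m') * x : ℝ) * Complex.I) * (((2 * Real.pi * (α + m') : ℝ) : ℂ) * Complex.I)))) else (Complex.exp (((2 * Real.pi * b * θ * ((-1) * x + (1 / 2)) : ℝ) : ℂ) * Complex.I) * ((((2 * Real.pi * b * θ * (-1) : ℝ) : ℂ) * Complex.I) * (∑ m' ∈ S', a m' * Complex.exp ((2 * Real.pi * (α + m') * x : ℝ) * Complex.I))) + Complex.exp (((2 * Real.pi * b * θ * ((-1) * x + (1 / 2)) : ℝ) : ℂ) * Complex.I) * (∑ m' ∈ S', a m' * (Complex.exp ((2 * Real.pi * (α + m') * x : ℝ) * Complex.I) * (((2 * Real.pi * (α + m') : ℝ) : ℂ) * Complex.I))))) := ⟨_, rfl⟩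
  have hmeas : Measurable h := by
    rw [hh]
    exact Measurable.ite measurableSet_Iic cTR.measurable (Measurable.ite measurableSet_Iic cCE.measurable cCR.measurable)
  have hbd' : ∀ x : ℝ, ‖h x‖ ≤ κ * ‖(∑ m' ∈ S', a m' * Complex.exp ((2 * Real.pi * (α + m') * x : ℝ) * Complex.I))‖ + ‖(∑ m' ∈ S', a m' * (Complex.exp ((2 * Real.pi * (α + m') * x : ℝ) * Complex.I) * (((2 * Real.pi * (α + m') : ℝ) : ℂ) * Complex.I)))‖ := by
    intro x
    simp only [hh]
    split_ifs
    · exact bH _ _ x (by norm_num)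
    · exact bH _ _ x (by norm_num)
    · exact bH _ _ x (by norm_num)
  have hbd : ∀ x : ℝ, ‖h x‖ ≤ κ * A₁ + A₂ := fun x =>
    (hbd' x).trans (add_le_add (mul_le_mul_of_nonneg_left (bψ x) hκ0) (bψ' x))
  -- Young, pointwise and integrated (`t = θ² + 1`)
  set t : ℝ := θ ^ 2 + 1 with ht
  have ht0 : 0 < t := by positivity
  have hY : ∀ x ∈ Icc (-(1 / 2) : ℝ) (1 / 2 : ℝ), ‖h x‖ ^ 2 ≤ (1 + 1 / t) * κ ^ 2 * ‖(∑ m' ∈ S', a m' * Complex.exp ((2 * Real.pi * (α + m') * x : ℝ) * Complex.I))‖ ^ 2 + (1 + t) * ‖(∑ m' ∈ S', a m' * (Complex.exp ((2 * Real.pi * (α + m') * x : ℝ) * Complex.I) * (((2 * Real.pi * (α + m') : ℝ) : ℂ) * Complex.I)))‖ ^ 2 := by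
    intro x _
    have h1 := hbd' x
    have h2 := add_sq_le_young (p := κ * ‖(∑ m' ∈ S', a m' * Complex.exp ((2 * Real.pi * (α + m') * x : ℝ) * Complex.I))‖) (q := ‖(∑ m' ∈ S', a m' * (Complex.exp ((2 * Real.pi * (α + m') * x : ℝ) * Complex.I) * (((2 * Real.pi * (α + m') : ℝ) : ℂ) * Complex.I)))‖) ht0
    have h3 : ‖h x‖ ^ 2 ≤ (κ * ‖(∑ m' ∈ S', a m' * Complex.exp ((2 * Real.pi * (α + m') * x : ℝ) * Complex.I))‖ + ‖(∑ m' ∈ S', a m' * (Complex.exp ((2 * Real.pi * (α + m') * x : ℝ) * Complex.I) * (((2 * Real.pi * (α + m') : ℝ) : ℂ) * Complex.I)))‖) ^ 2 := pow_le_pow_left₀ (norm_nonneg _) h1 2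
    rw [mul_pow] at h2
    linarith
  have hI2 : IntervalIntegrable (fun x : ℝ => ‖h x‖ ^ 2) volume (-(1 / 2) : ℝ) (1 / 2 : ℝ) := by
    refine intervalIntegrable_of_bounded_measurable (hmeas.norm.pow_const 2) (C := (κ * A₁ + A₂) ^ 2) (fun x => ?_) _ _
    rw [Real.norm_eq_abs, abs_of_nonneg (by positivity)]
    exact pow_le_pow_left₀ (norm_nonneg _) (hbd x) 2
  have ih : ∫ x in (-(1 / 2) : ℝ)..(1 / 2 : ℝ), ‖h x‖ ^ 2 ≤
      (1 + 1 / t) * κ ^ 2 * (∑ m' ∈ S', ‖a m'‖ ^ 2) + (1 + t) * ∑ m' ∈ S', (2 * Real.pi * (α + m')) ^ 2 * ‖a m'‖ ^ 2 := by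
    have hgc : Continuous fun x : ℝ => (1 + 1 / t) * κ ^ 2 * ‖(∑ m' ∈ S', a m' * Complex.exp ((2 * Real.pi * (α + m') * x : ℝ) * Complex.I))‖ ^ 2 + (1 + t) * ‖(∑ m' ∈ S', a m' * (Complex.exp ((2 * Real.pi * (α + m') * x : ℝ) * Complex.I) * (((2 * Real.pi * (α + m') : ℝ) : ℂ) * Complex.I)))‖ ^ 2 := by fun_prop
    refine (intervalIntegral.integral_mono_on (by norm_num) hI2 (hgc.intervalIntegrable _ _) hY).trans (le_of_eq ?_)
    rw [intervalIntegral.integral_add ((by fun_prop : Continuous fun x : ℝ => (1 + 1 / t) * κ ^ 2 * ‖(∑ m' ∈ S', a m' * Complex.exp ((2 * Real.pi * (α + m') * x : ℝ) * Complex.I))‖ ^ 2).intervalIntegrable _ _)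
      ((by fun_prop : Continuous fun x : ℝ => (1 + t) * ‖(∑ m' ∈ S', a m' * (Complex.exp ((2 * Real.pi * (α + m') * x : ℝ) * Complex.I) * (((2 * Real.pi * (α + m') : ℝ) : ℂ) * Complex.I)))‖ ^ 2).intervalIntegrable _ _),
      intervalIntegral.integral_const_mul, intervalIntegral.integral_const_mul, nψ, nψ']
  -- Bessel for `h` and for `f`
  have ph := hasSum_sq_coeff_of_bound hmeas.aestronglyMeasurable hbd α
  have bessel_h := sum_le_hasSum S (fun n _ => by positivity) ph
  have pf := hasSum_sq_coeff hfc α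
  have bessel_f := sum_le_hasSum S (fun n _ => by positivity) pf
  have nf2 : ∫ x in (-(1 / 2) : ℝ)..(1 / 2 : ℝ), ‖(Complex.exp (((2 * Real.pi * b * θ * triWave x : ℝ) : ℂ) * Complex.I) * (∑ m' ∈ S', a m' * Complex.exp ((2 * Real.pi * (α + m') * x : ℝ) * Complex.I)))‖ ^ 2 = ∑ m' ∈ S', ‖a m'‖ ^ 2 := by
    rw [← nψ]; exact intervalIntegral.integral_congr fun x _ => by rw [nf]
  rw [nf2] at bessel_f
  -- integration by parts, piece by piece: `ĥ(m) = 2πi(α+m)·f̂(m)`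
  have hfe : ∀ (m : ℤ) (u v : ℝ), IntervalIntegrable (fun x : ℝ => (Complex.exp (((2 * Real.pi * b * θ * triWave x : ℝ) : ℂ) * Complex.I) * (∑ m' ∈ S', a m' * Complex.exp ((2 * Real.pi * (α + m') * x : ℝ) * Complex.I))) * Complex.exp (-(2 * Real.pi * (α + m) * x : ℝ) * Complex.I)) volume u v :=
    fun m u v => (hfc.mul (by fun_prop)).intervalIntegrable u v
  have ibp : ∀ m : ℤ, ∫ x in (-(1 / 2) : ℝ)..(1 / 2 : ℝ), h x * Complex.exp (-(2 * Real.pi * (α + m) * x : ℝ) * Complex.I) = (((2 * Real.pi * (α + m) : ℝ) : ℂ) * Complex.I) * ∫ x in (-(1 / 2) : ℝ)..(1 / 2 : ℝ), (Complex.exp (((2 * Real.pi * b * θ * triWave x : ℝ) : ℂ) * Complex.I) * (∑ m' ∈ S', a m' * Complex.exp ((2 * Real.pi * (α + m') * x : ℝ) * Complex.I))) * Complex.exp (-(2 * Real.pi * (α + m) * x : ℝ) * Complex.I) := by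
    intro m
    have hme : Measurable fun x : ℝ => h x * Complex.exp (-(2 * Real.pi * (α + m) * x : ℝ) * Complex.I) := hmeas.mul (by fun_prop : Continuous fun x : ℝ => Complex.exp (-(2 * Real.pi * (α + m) * x : ℝ) * Complex.I)).measurable
    have hIe : ∀ u v : ℝ, IntervalIntegrable (fun x : ℝ => h x * Complex.exp (-(2 * Real.pi * (α + m) * x : ℝ) * Complex.I)) volume u v := by
      intro u v
      refine intervalIntegrable_of_bounded_measurable hme (C := κ * A₁ + A₂) (fun x => ?_) u v
      show ‖h x * Complex.exp (-(2 * Real.pi * (α + m) * x : ℝ) * Complex.I)‖ ≤ κ * A₁ + A₂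
      rw [norm_mul, show -((2 * Real.pi * (α + m) * x : ℝ) : ℂ) * Complex.I = ((-(2 * Real.pi * (α + m) * x) : ℝ) : ℂ) * Complex.I by push_cast; ring,
        Complex.norm_exp_ofReal_mul_I, mul_one]
      exact hbd x
    -- split the `h`-integral at the kinks
    have s1 := intervalIntegral.integral_add_adjacent_intervals (hIe (-(1 / 2) : ℝ) (-(1 / 4) : ℝ)) (hIe (-(1 / 4) : ℝ) (1 / 4 : ℝ))
    have s2 := intervalIntegral.integral_add_adjacent_intervals ((hIe (-(1 / 2) : ℝ) (-(1 / 4) : ℝ)).trans (hIe (-(1 / 4) : ℝ) (1 / 4 : ℝ))) (hIe (1 / 4 : ℝ) (1 / 2 : ℝ))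
    -- on each piece `h` is the smooth piece derivative (the `if` is decided on the half-open piece)
    have q1 : ∫ x in (-(1 / 2) : ℝ)..(-(1 / 4) : ℝ), h x * Complex.exp (-(2 * Real.pi * (α + m) * x : ℝ) * Complex.I) = ∫ x in (-(1 / 2) : ℝ)..(-(1 / 4) : ℝ), (Complex.exp (((2 * Real.pi * b * θ * ((-1) * x + (-(1 / 2))) : ℝ) : ℂ) * Complex.I) * ((((2 * Real.pi * b * θ * (-1) : ℝ) : ℂ) * Complex.I) * (∑ m' ∈ S', a m' * Complex.exp ((2 * Real.pi * (α + m') * x : ℝ) * Complex.I))) + Complex.exp (((2 * Real.pi * b * θ * ((-1) * x + (-(1 / 2))) : ℝ) : ℂ) * Complex.I) * (∑ m' ∈ S', a m' * (Complex.exp ((2 * Real.pi * (α + m') * x : ℝ) * Complex.I) * (((2 * Real.pi * (α + m') : ℝ) : ℂ) * Complex.I)))) * Complex.exp (-(2 * Real.pi * (α + m) * x : ℝ) * Complex.I) := by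
      refine intervalIntegral.integral_congr_ae (ae_of_all _ fun x hx => ?_)
      rw [Set.uIoc_of_le (by norm_num)] at hx
      simp only [hh, if_pos hx.2]
    have q2 : ∫ x in (-(1 / 4) : ℝ)..(1 / 4 : ℝ), h x * Complex.exp (-(2 * Real.pi * (α + m) * x : ℝ) * Complex.I) = ∫ x in (-(1 / 4) : ℝ)..(1 / 4 : ℝ), (Complex.exp (((2 * Real.pi * b * θ * (1 * x + 0) : ℝ) : ℂ) * Complex.I) * ((((2 * Real.pi * b * θ * 1 : ℝ) : ℂ) * Complex.I) * (∑ m' ∈ S', a m' * Complex.exp ((2 * Real.pi * (α + m') * x : ℝ) * Complex.I))) + Complex.exp (((2 * Real.pi * b * θ * (1 * x + 0) : ℝ) : ℂ) * Complex.I) * (∑ m' ∈ S', a m' * (Complex.exp ((2 * Real.pi * (α + m') * x : ℝ) * Complex.I) * (((2 * Real.pi * (α + m') : ℝ) : ℂ) * Complex.I)))) * Complex.exp (-(2 * Real.pi * (α + m) * x : ℝ) * Complex.I) := by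
      refine intervalIntegral.integral_congr_ae (ae_of_all _ fun x hx => ?_)
      rw [Set.uIoc_of_le (by norm_num)] at hx
      simp only [hh, if_neg (not_le.2 hx.1), if_pos hx.2]
    have q3 : ∫ x in (1 / 4 : ℝ)..(1 / 2 : ℝ), h x * Complex.exp (-(2 * Real.pi * (α + m) * x : ℝ) * Complex.I) = ∫ x in (1 / 4 : ℝ)..(1 / 2 : ℝ), (Complex.exp (((2 * Real.pi * b * θ * ((-1) * x + (1 / 2)) : ℝ) : ℂ) * Complex.I) * ((((2 * Real.pi * b * θ * (-1) : ℝ) : ℂ) * Complex.I) * (∑ m' ∈ S', a m' * Complex.exp ((2 * Real.pi * (α + m') * x : ℝ) * Complex.I))) + Complex.exp (((2 * Real.pi * b * θ * ((-1) * x + (1 / 2)) : ℝ) : ℂ) * Complex.I) * (∑ m' ∈ S', a m' * (Complex.exp ((2 * Real.pi * (α + m') * x : ℝ) * Complex.I) * (((2 * Real.pi * (α + m') : ℝ) : ℂ) * Complex.I)))) * Complex.exp (-(2 * Real.pi * (α + m) * x : ℝ) * Complex.I) := by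
      refine intervalIntegral.integral_congr_ae (ae_of_all _ fun x hx => ?_)
      rw [Set.uIoc_of_le (by norm_num)] at hx
      have hx1 : ¬ x ≤ -(1 / 4 : ℝ) := by intro h'; linarith [hx.1]
      simp only [hh, if_neg hx1, if_neg (not_le.2 hx.1)]
    -- integration by parts on each piece
    have p1 := integral_piece_deriv_mul_conjExp b θ (-1) (-(1 / 2)) α S' a m (-(1 / 2) : ℝ) (-(1 / 4) : ℝ)
    have p2 := integral_piece_deriv_mul_conjExp b θ 1 0 α S' a m (-(1 / 4) : ℝ) (1 / 4 : ℝ)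
    have p3 := integral_piece_deriv_mul_conjExp b θ (-1) (1 / 2) α S' a m (1 / 4 : ℝ) (1 / 2 : ℝ)
    -- on each closed piece `f` is the smooth piece function
    have r1 : ∫ x in (-(1 / 2) : ℝ)..(-(1 / 4) : ℝ), (Complex.exp (((2 * Real.pi * b * θ * ((-1) * x + (-(1 / 2))) : ℝ) : ℂ) * Complex.I) * (∑ m' ∈ S', a m' * Complex.exp ((2 * Real.pi * (α + m') * x : ℝ) * Complex.I))) * Complex.exp (-(2 * Real.pi * (α + m) * x : ℝ) * Complex.I) = ∫ x in (-(1 / 2) : ℝ)..(-(1 / 4) : ℝ), (Complex.exp (((2 * Real.pi * b * θ * triWave x : ℝ) : ℂ) * Complex.I) * (∑ m' ∈ S', a m' * Complex.exp ((2 * Real.pi * (α + m') * x : ℝ) * Complex.I))) * Complex.exp (-(2 * Real.pi * (α + m) * x : ℝ) * Complex.I) := by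
      refine intervalIntegral.integral_congr fun x hx => ?_
      rw [Set.uIcc_of_le (by norm_num)] at hx
      rw [triWave_eq_neg_half_sub (by linarith [hx.1]) hx.2, show (-1 : ℝ) * x + -(1 / 2) = -(1 / 2) - x by ring]
    have r2 : ∫ x in (-(1 / 4) : ℝ)..(1 / 4 : ℝ), (Complex.exp (((2 * Real.pi * b * θ * (1 * x + 0) : ℝ) : ℂ) * Complex.I) * (∑ m' ∈ S', a m' * Complex.exp ((2 * Real.pi * (α + m') * x : ℝ) * Complex.I))) * Complex.exp (-(2 * Real.pi * (α + m) * x : ℝ) * Complex.I) = ∫ x in (-(1 / 4) : ℝ)..(1 / 4 : ℝ), (Complex.exp (((2 * Real.pi * b * θ * triWave x : ℝ) : ℂ) * Complex.I) * (∑ m' ∈ S', a m' * Complex.exp ((2 * Real.pi * (α + m') * x : ℝ) * Complex.I))) * Complex.exp (-(2 * Real.pi * (α + m) * x : ℝ) * Complex.I) := by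
      refine intervalIntegral.integral_congr fun x hx => ?_
      rw [Set.uIcc_of_le (by norm_num)] at hx
      rw [triWave_eq_self hx.1 hx.2, show (1 : ℝ) * x + 0 = x by ring]
    have r3 : ∫ x in (1 / 4 : ℝ)..(1 / 2 : ℝ), (Complex.exp (((2 * Real.pi * b * θ * ((-1) * x + (1 / 2)) : ℝ) : ℂ) * Complex.I) * (∑ m' ∈ S', a m' * Complex.exp ((2 * Real.pi * (α + m') * x : ℝ) * Complex.I))) * Complex.exp (-(2 * Real.pi * (α + m) * x : ℝ) * Complex.I) = ∫ x in (1 / 4 : ℝ)..(1 / 2 : ℝ), (Complex.exp (((2 * Real.pi * b * θ * triWave x : ℝ) : ℂ) * Complex.I) * (∑ m' ∈ S', a m' * Complex.exp ((2 * Real.pi * (α + m') * x : ℝ) * Complex.I))) * Complex.exp (-(2 * Real.pi * (α + m) * x : ℝ) * Complex.I) := by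
      refine intervalIntegral.integral_congr fun x hx => ?_
      rw [Set.uIcc_of_le (by norm_num)] at hx
      rw [triWave_eq_half_sub hx.1 (by linarith [hx.2]), show (-1 : ℝ) * x + 1 / 2 = 1 / 2 - x by ring]
    -- the `f`-integral re-assembled
    have t1 := intervalIntegral.integral_add_adjacent_intervals (hfe m (-(1 / 2) : ℝ) (-(1 / 4) : ℝ)) (hfe m (-(1 / 4) : ℝ) (1 / 4 : ℝ))
    have t2 := intervalIntegral.integral_add_adjacent_intervals ((hfe m (-(1 / 2) : ℝ) (-(1 / 4) : ℝ)).trans (hfe m (-(1 / 4) : ℝ) (1 / 4 : ℝ))) (hfe m (1 / 4 : ℝ) (1 / 2 : ℝ))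
    -- boundary terms: continuity at the kinks, Bloch periodicity at the ends
    have T1 : Complex.exp (((2 * Real.pi * b * θ * ((-1) * (-(1 / 4) : ℝ) + (-(1 / 2))) : ℝ) : ℂ) * Complex.I) = Complex.exp (((2 * Real.pi * b * θ * (1 * (-(1 / 4) : ℝ) + 0) : ℝ) : ℂ) * Complex.I) := by
      norm_num
    have T2 : Complex.exp (((2 * Real.pi * b * θ * (1 * (1 / 4 : ℝ) + 0) : ℝ) : ℂ) * Complex.I) = Complex.exp (((2 * Real.pi * b * θ * ((-1) * (1 / 4 : ℝ) + (1 / 2)) : ℝ) : ℂ) * Complex.I) := by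
      norm_num
    have T3a : Complex.exp (((2 * Real.pi * b * θ * ((-1) * (1 / 2 : ℝ) + (1 / 2)) : ℝ) : ℂ) * Complex.I) = Complex.exp (((2 * Real.pi * b * θ * ((-1) * (-(1 / 2) : ℝ) + (-(1 / 2))) : ℝ) : ℂ) * Complex.I) := by
      norm_num
    have T3 : (Complex.exp (((2 * Real.pi * b * θ * ((-1) * (1 / 2 : ℝ) + (1 / 2)) : ℝ) : ℂ) * Complex.I) * (∑ m' ∈ S', a m' * Complex.exp ((2 * Real.pi * (α + m') * (1 / 2 : ℝ) : ℝ) * Complex.I))) * Complex.exp (-(2 * Real.pi * (α + m) * (1 / 2 : ℝ) : ℝ) * Complex.I) = (Complex.exp (((2 * Real.pi * b * θ * ((-1) * (-(1 / 2) : ℝ) + (-(1 / 2))) : ℝ) : ℂ) * Complex.I) * (∑ m' ∈ S', a m' * Complex.exp ((2 * Real.pi * (α + m') * (-(1 / 2) : ℝ) : ℝ) * Complex.I))) * Complex.exp (-(2 * Real.pi * (α + m) * (-(1 / 2) : ℝ) : ℝ) * Complex.I) := by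
      rw [mul_assoc (Complex.exp (((2 * Real.pi * b * θ * ((-1) * (1 / 2 : ℝ) + (1 / 2)) : ℝ) : ℂ) * Complex.I)), mul_assoc (Complex.exp (((2 * Real.pi * b * θ * ((-1) * (-(1 / 2) : ℝ) + (-(1 / 2))) : ℝ) : ℂ) * Complex.I)), T3a, blochPoly_mul_conjExp_half]
    rw [← s2, ← s1, q1, q2, q3, p1, p2, p3, r1, r2, r3, T1, T2, T3, ← t2, ← t1]
    ring
  -- `‖ĥ(m)‖² = 4π²(α+m)²‖f̂(m)‖²`
  have key : ∀ m : ℤ, ((α + m) ^ 2 + b ^ 2) * ‖∫ x in (-(1 / 2) : ℝ)..(1 / 2 : ℝ), (Complex.exp (((2 * Real.pi * b * θ * triWave x : ℝ) : ℂ) * Complex.I) * (∑ m' ∈ S', a m' * Complex.exp ((2 * Real.pi * (α + m') * x : ℝ) * Complex.I))) * Complex.exp (-(2 * Real.pi * (α + m) * x : ℝ) * Complex.I)‖ ^ 2 =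
      b ^ 2 * ‖∫ x in (-(1 / 2) : ℝ)..(1 / 2 : ℝ), (Complex.exp (((2 * Real.pi * b * θ * triWave x : ℝ) : ℂ) * Complex.I) * (∑ m' ∈ S', a m' * Complex.exp ((2 * Real.pi * (α + m') * x : ℝ) * Complex.I))) * Complex.exp (-(2 * Real.pi * (α + m) * x : ℝ) * Complex.I)‖ ^ 2 + (1 / (4 * Real.pi ^ 2)) * ‖∫ x in (-(1 / 2) : ℝ)..(1 / 2 : ℝ), h x * Complex.exp (-(2 * Real.pi * (α + m) * x : ℝ) * Complex.I)‖ ^ 2 := by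
    intro m
    rw [ibp m, norm_mul, norm_mul, Complex.norm_real, Complex.norm_I, mul_one, Real.norm_eq_abs, mul_pow, sq_abs]
    generalize ‖∫ x in (-(1 / 2) : ℝ)..(1 / 2 : ℝ), (Complex.exp (((2 * Real.pi * b * θ * triWave x : ℝ) : ℂ) * Complex.I) * (∑ m' ∈ S', a m' * Complex.exp ((2 * Real.pi * (α + m') * x : ℝ) * Complex.I))) * Complex.exp (-(2 * Real.pi * (α + m) * x : ℝ) * Complex.I)‖ = N
    field_simp
    ring
  -- assemble
  set A0 : ℝ := ∑ m' ∈ S', ‖a m'‖ ^ 2 with hA0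
  set A2 : ℝ := ∑ m' ∈ S', (α + m') ^ 2 * ‖a m'‖ ^ 2 with hA2
  have hA0p : 0 ≤ A0 := Finset.sum_nonneg fun _ _ => by positivity
  have hA2p : 0 ≤ A2 := Finset.sum_nonneg fun _ _ => by positivity
  have e1 : ∑ m' ∈ S', (2 * Real.pi * (α + m')) ^ 2 * ‖a m'‖ ^ 2 = 4 * Real.pi ^ 2 * A2 := by
    rw [hA2, Finset.mul_sum]; exact Finset.sum_congr rfl fun m' _ => by ring
  have e2 : ∑ m' ∈ S', ((α + m') ^ 2 + b ^ 2) * ‖a m'‖ ^ 2 = A2 + b ^ 2 * A0 := by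
    rw [hA2, hA0, Finset.mul_sum, ← Finset.sum_add_distrib]; exact Finset.sum_congr rfl fun m' _ => by ring
  have eκ : κ ^ 2 = 4 * Real.pi ^ 2 * b ^ 2 * θ ^ 2 := by
    rw [hκ]; ring_nf; rw [sq_abs, sq_abs]
  rw [e1] at ih
  calc ∑ m ∈ S, ((α + m) ^ 2 + b ^ 2) * ‖∫ x in (-(1 / 2) : ℝ)..(1 / 2 : ℝ), (Complex.exp (((2 * Real.pi * b * θ * triWave x : ℝ) : ℂ) * Complex.I) * (∑ m' ∈ S', a m' * Complex.exp ((2 * Real.pi * (α + m') * x : ℝ) * Complex.I))) * Complex.exp (-(2 * Real.pi * (α + m) * x : ℝ) * Complex.I)‖ ^ 2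
      = b ^ 2 * ∑ m ∈ S, ‖∫ x in (-(1 / 2) : ℝ)..(1 / 2 : ℝ), (Complex.exp (((2 * Real.pi * b * θ * triWave x : ℝ) : ℂ) * Complex.I) * (∑ m' ∈ S', a m' * Complex.exp ((2 * Real.pi * (α + m') * x : ℝ) * Complex.I))) * Complex.exp (-(2 * Real.pi * (α + m) * x : ℝ) * Complex.I)‖ ^ 2 +
          (1 / (4 * Real.pi ^ 2)) * ∑ m ∈ S, ‖∫ x in (-(1 / 2) : ℝ)..(1 / 2 : ℝ), h x * Complex.exp (-(2 * Real.pi * (α + m) * x : ℝ) * Complex.I)‖ ^ 2 := by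
        rw [Finset.sum_congr rfl fun m _ => key m, Finset.sum_add_distrib, Finset.mul_sum, Finset.mul_sum]
    _ ≤ b ^ 2 * A0 + (1 / (4 * Real.pi ^ 2)) * ((1 + 1 / t) * κ ^ 2 * A0 + (1 + t) * (4 * Real.pi ^ 2 * A2)) := by
        exact add_le_add (mul_le_mul_of_nonneg_left bessel_f (sq_nonneg b)) (mul_le_mul_of_nonneg_left (bessel_h.trans ih) (by positivity))
    _ ≤ (θ ^ 2 + 2) * ∑ m' ∈ S', ((α + m') ^ 2 + b ^ 2) * ‖a m'‖ ^ 2 := by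
        rw [e2, eκ]
        have hq : θ ^ 2 / t ≤ 1 := by rw [div_le_one ht0, ht]; linarith
        have hπ : (0 : ℝ) < 4 * Real.pi ^ 2 := by positivity
        have e3 : b ^ 2 * A0 + 1 / (4 * Real.pi ^ 2) * ((1 + 1 / t) * (4 * Real.pi ^ 2 * b ^ 2 * θ ^ 2) * A0 + (1 + t) * (4 * Real.pi ^ 2 * A2)) =
            b ^ 2 * A0 * (1 + θ ^ 2 + θ ^ 2 / t) + (1 + t) * A2 := by
          field_simp
          ring
        rw [e3, ht]
        have hb2 : 0 ≤ b ^ 2 * A0 := by positivity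
        nlinarith [mul_le_mul_of_nonneg_left hq hb2]

/-- **THE ENERGY-FORM TRANSPORT BOUND (L-i-b in full).** For a class offset `α`, a line `b ≠ 0`, a strain `θ`, any finite set `S` of source rows with
amplitudes `z`, and any finite output window `S′`:
`Σ_{m′∈S′} |∫_{−½}^{½} (Σ_{m∈S} z(m)e^{2πi(α+m)x})·e^{−2πibθ·tri(x)}·e^{−2πi(α+m′)x} dx|² / ((α+m′)²+b²) ≤ (θ²+2)·Σ_{m∈S} |z(m)|²/((α+m)²+b²)` —
p4's `vTransport`/`hTransport` amplify the windowed level energy of every column/row by at most `θ² + 2` (= 66 at θ = 8), uniformly in the window,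
the shell, the class and the coherence of the input. [cite: ElgindiLissMattingly2025, §1 (H_α, V_α)] -/
theorem transport_energy_duality (α θ : ℝ) {b : ℝ} (hb : b ≠ 0) (S S' : Finset ℤ) (z : ℤ → ℂ) :
    ∑ m' ∈ S', ‖∫ x in (-(1 / 2 : ℝ))..(1 / 2), ((∑ m ∈ S, z m * Complex.exp ((2 * Real.pi * (α + m) * x : ℝ) * Complex.I)) * Complex.exp (-((2 * Real.pi * b * θ * triWave x : ℝ) : ℂ) * Complex.I)) * Complex.exp (-(2 * Real.pi * (α + m') * x : ℝ) * Complex.I)‖ ^ 2 / ((α + m') ^ 2 + b ^ 2) ≤ (θ ^ 2 + 2) * ∑ m ∈ S, ‖z m‖ ^ 2 / ((α + m) ^ 2 + b ^ 2) := by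
  obtain ⟨c, hc⟩ : ∃ c : ℤ → ℂ, ∀ m' : ℤ, c m' = ∫ x in (-(1 / 2 : ℝ))..(1 / 2), ((∑ m ∈ S, z m * Complex.exp ((2 * Real.pi * (α + m) * x : ℝ) * Complex.I)) * Complex.exp (-((2 * Real.pi * b * θ * triWave x : ℝ) : ℂ) * Complex.I)) * Complex.exp (-(2 * Real.pi * (α + m') * x : ℝ) * Complex.I) := ⟨_, fun _ => rfl⟩
  simp only [← hc]
  have hW : ∀ m : ℤ, 0 < ((α + m) ^ 2 + b ^ 2) := fun m => by positivity
  obtain ⟨a, ha⟩ : ∃ a : ℤ → ℂ, ∀ m' : ℤ, a m' = c m' / ((((α + m') ^ 2 + b ^ 2) : ℝ) : ℂ) := ⟨_, fun _ => rfl⟩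
  set L : ℝ := ∑ m' ∈ S', ‖c m'‖ ^ 2 / ((α + m') ^ 2 + b ^ 2) with hL
  set R : ℝ := ∑ m ∈ S, ‖z m‖ ^ 2 / ((α + m) ^ 2 + b ^ 2) with hR
  have hL0 : 0 ≤ L := Finset.sum_nonneg fun m' _ => by positivity
  have hR0 : 0 ≤ R := Finset.sum_nonneg fun m _ => by positivity
  have hgu : Continuous fun x : ℝ => (∑ m ∈ S, z m * Complex.exp ((2 * Real.pi * (α + m) * x : ℝ) * Complex.I)) * Complex.exp (-((2 * Real.pi * b * θ * triWave x : ℝ) : ℂ) * Complex.I) := by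
    have := continuous_triWave'
    fun_prop
  have hf : Continuous fun x : ℝ => Complex.exp (((2 * Real.pi * b * θ * triWave x : ℝ) : ℂ) * Complex.I) * (∑ m' ∈ S', a m' * Complex.exp ((2 * Real.pi * (α + m') * x : ℝ) * Complex.I)) := by
    have := continuous_triWave'
    fun_prop
  -- (1) `⟨gu, ψ⟩ = L`
  have k1 : ∫ x in (-(1 / 2 : ℝ))..(1 / 2), ((∑ m ∈ S, z m * Complex.exp ((2 * Real.pi * (α + m) * x : ℝ) * Complex.I)) * Complex.exp (-((2 * Real.pi * b * θ * triWave x : ℝ) : ℂ) * Complex.I)) * (starRingEnd ℂ) (∑ m' ∈ S', a m' * Complex.exp ((2 * Real.pi * (α + m') * x : ℝ) * Complex.I)) = (L : ℂ) := by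
    rw [integral_mul_conj_blochPoly hgu α S' a]
    simp only [← hc]
    rw [hL]
    push_cast
    refine Finset.sum_congr rfl fun k _ => ?_
    rw [ha, map_div₀, Complex.conj_ofReal, div_mul_eq_mul_div, ← Complex.normSq_eq_conj_mul_self, Complex.normSq_eq_norm_sq]
    push_cast
    ring
  -- (2) `⟨gu, ψ⟩ = ⟨g, ūψ⟩ = Σ z(m)·conj((ūψ)^(m))`
  have k2 : ∫ x in (-(1 / 2 : ℝ))..(1 / 2), ((∑ m ∈ S, z m * Complex.exp ((2 * Real.pi * (α + m) * x : ℝ) * Complex.I)) * Complex.exp (-((2 * Real.pi * b * θ * triWave x : ℝ) : ℂ) * Complex.I)) * (starRingEnd ℂ) (∑ m' ∈ S', a m' * Complex.exp ((2 * Real.pi * (α + m') * x : ℝ) * Complex.I)) =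
      ∑ m ∈ S, z m * (starRingEnd ℂ) (∫ x in (-(1 / 2) : ℝ)..(1 / 2 : ℝ), (Complex.exp (((2 * Real.pi * b * θ * triWave x : ℝ) : ℂ) * Complex.I) * (∑ m' ∈ S', a m' * Complex.exp ((2 * Real.pi * (α + m') * x : ℝ) * Complex.I))) * Complex.exp (-(2 * Real.pi * (α + m) * x : ℝ) * Complex.I)) := by
    have e : ∀ x : ℝ, ((∑ m ∈ S, z m * Complex.exp ((2 * Real.pi * (α + m) * x : ℝ) * Complex.I)) * Complex.exp (-((2 * Real.pi * b * θ * triWave x : ℝ) : ℂ) * Complex.I)) * (starRingEnd ℂ) (∑ m' ∈ S', a m' * Complex.exp ((2 * Real.pi * (α + m') * x : ℝ) * Complex.I)) = (∑ m ∈ S, z m * Complex.exp ((2 * Real.pi * (α + m) * x : ℝ) * Complex.I)) * (starRingEnd ℂ) (Complex.exp (((2 * Real.pi * b * θ * triWave x : ℝ) : ℂ) * Complex.I) * (∑ m' ∈ S', a m' * Complex.exp ((2 * Real.pi * (α + m') * x : ℝ) * Complex.I))) := by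
      intro x
      rw [map_mul, ← conj_transportPhase' b θ x, Complex.conj_conj]
      ring
    simp_rw [e]
    exact integral_blochPoly_mul_conj hf α S z
  -- (3) `L ≤ Σ ‖z‖·‖(ūψ)^‖`
  have k3 : L ≤ ∑ m ∈ S, ‖z m‖ * ‖(∫ x in (-(1 / 2) : ℝ)..(1 / 2 : ℝ), (Complex.exp (((2 * Real.pi * b * θ * triWave x : ℝ) : ℂ) * Complex.I) * (∑ m' ∈ S', a m' * Complex.exp ((2 * Real.pi * (α + m') * x : ℝ) * Complex.I))) * Complex.exp (-(2 * Real.pi * (α + m) * x : ℝ) * Complex.I))‖ := by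
    have h1 : (L : ℂ) = ∑ m ∈ S, z m * (starRingEnd ℂ) (∫ x in (-(1 / 2) : ℝ)..(1 / 2 : ℝ), (Complex.exp (((2 * Real.pi * b * θ * triWave x : ℝ) : ℂ) * Complex.I) * (∑ m' ∈ S', a m' * Complex.exp ((2 * Real.pi * (α + m') * x : ℝ) * Complex.I))) * Complex.exp (-(2 * Real.pi * (α + m) * x : ℝ) * Complex.I)) := k1.symm.trans k2
    have hre : L = (∑ m ∈ S, z m * (starRingEnd ℂ) (∫ x in (-(1 / 2) : ℝ)..(1 / 2 : ℝ), (Complex.exp (((2 * Real.pi * b * θ * triWave x : ℝ) : ℂ) * Complex.I) * (∑ m' ∈ S', a m' * Complex.exp ((2 * Real.pi * (α + m') * x : ℝ) * Complex.I))) * Complex.exp (-(2 * Real.pi * (α + m) * x : ℝ) * Complex.I))).re := by rw [← h1, Complex.ofReal_re]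
    rw [hre]
    refine (Complex.re_le_norm _).trans ((norm_sum_le _ _).trans (le_of_eq ?_))
    exact Finset.sum_congr rfl fun m _ => by rw [norm_mul, Complex.norm_conj]
  -- (4) Cauchy–Schwarz with the weights `W`
  have k4 : (∑ m ∈ S, ‖z m‖ * ‖(∫ x in (-(1 / 2) : ℝ)..(1 / 2 : ℝ), (Complex.exp (((2 * Real.pi * b * θ * triWave x : ℝ) : ℂ) * Complex.I) * (∑ m' ∈ S', a m' * Complex.exp ((2 * Real.pi * (α + m') * x : ℝ) * Complex.I))) * Complex.exp (-(2 * Real.pi * (α + m) * x : ℝ) * Complex.I))‖) ^ 2 ≤ R * ∑ m ∈ S, ((α + m) ^ 2 + b ^ 2) * ‖(∫ x in (-(1 / 2) : ℝ)..(1 / 2 : ℝ), (Complex.exp (((2 * Real.pi * b * θ * triWave x : ℝ) : ℂ) * Complex.I) * (∑ m' ∈ S', a m' * Complex.exp ((2 * Real.pi * (α + m') * x : ℝ) * Complex.I))) * Complex.exp (-(2 * Real.pi * (α + m) * x : ℝ) * Complex.I))‖ ^ 2 := by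
    have h := Finset.sum_mul_sq_le_sq_mul_sq S (fun m => ‖z m‖ / Real.sqrt ((α + m) ^ 2 + b ^ 2)) (fun m => Real.sqrt ((α + m) ^ 2 + b ^ 2) * ‖(∫ x in (-(1 / 2) : ℝ)..(1 / 2 : ℝ), (Complex.exp (((2 * Real.pi * b * θ * triWave x : ℝ) : ℂ) * Complex.I) * (∑ m' ∈ S', a m' * Complex.exp ((2 * Real.pi * (α + m') * x : ℝ) * Complex.I))) * Complex.exp (-(2 * Real.pi * (α + m) * x : ℝ) * Complex.I))‖)
    have e1 : ∑ m ∈ S, ‖z m‖ / Real.sqrt ((α + m) ^ 2 + b ^ 2) * (Real.sqrt ((α + m) ^ 2 + b ^ 2) * ‖(∫ x in (-(1 / 2) : ℝ)..(1 / 2 : ℝ), (Complex.exp (((2 * Real.pi * b * θ * triWave x : ℝ) : ℂ) * Complex.I) * (∑ m' ∈ S', a m' * Complex.exp ((2 * Real.pi * (α + m') * x : ℝ) * Complex.I))) * Complex.exp (-(2 * Real.pi * (α + m) * x : ℝ) * Complex.I))‖) = ∑ m ∈ S, ‖z m‖ * ‖(∫ x in (-(1 / 2) : ℝ)..(1 /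 2 : ℝ), (Complex.exp (((2 * Real.pi * b * θ * triWave x : ℝ) : ℂ) * Complex.I) * (∑ m' ∈ S', a m' * Complex.exp ((2 * Real.pi * (α + m') * x : ℝ) * Complex.I))) * Complex.exp (-(2 * Real.pi * (α + m) * x : ℝ) * Complex.I))‖ := by
      refine Finset.sum_congr rfl fun m _ => ?_
      have hs : Real.sqrt ((α + m) ^ 2 + b ^ 2) ≠ 0 := (Real.sqrt_pos.2 (hW m)).ne'
      rw [← mul_assoc, div_mul_cancel₀ _ hs]
    have e2 : ∑ m ∈ S, (‖z m‖ / Real.sqrt ((α + m) ^ 2 + b ^ 2)) ^ 2 = R := by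
      rw [hR]
      refine Finset.sum_congr rfl fun m _ => ?_
      rw [div_pow, Real.sq_sqrt (hW m).le]
    have e3 : ∑ m ∈ S, (Real.sqrt ((α + m) ^ 2 + b ^ 2) * ‖(∫ x in (-(1 / 2) : ℝ)..(1 / 2 : ℝ), (Complex.exp (((2 * Real.pi * b * θ * triWave x : ℝ) : ℂ) * Complex.I) * (∑ m' ∈ S', a m' * Complex.exp ((2 * Real.pi * (α + m') * x : ℝ) * Complex.I))) * Complex.exp (-(2 * Real.pi * (α + m) * x : ℝ) * Complex.I))‖) ^ 2 = ∑ m ∈ S, ((α + m) ^ 2 + b ^ 2) * ‖(∫ x in (-(1 / 2) : ℝ)..(1 / 2 : ℝ), (Complex.exp (((2 * Real.pi * b * θ * triWave x : ℝ) : ℂ) * Complex.I) * (∑ m' ∈ S', a m' * Complex.exp ((2 * Real.pi * (α + m') * x : ℝ) * Complex.I))) * Complex.exp (-(2 * Real.pi * (α + m) * x : ℝ) * Complex.I))‖ ^ 2 := by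
      refine Finset.sum_congr rfl fun m _ => ?_
      rw [mul_pow, Real.sq_sqrt (hW m).le]
    rw [e1, e2, e3] at h
    exact h
  -- (5) the analytic core, and `Σ W‖a‖² = L`
  have k5 := weighted_coeff_sum_conjTransport_le α b θ S S' a
  have k6 : ∑ m' ∈ S', ((α + m') ^ 2 + b ^ 2) * ‖a m'‖ ^ 2 = L := by
    rw [hL]
    refine Finset.sum_congr rfl fun m' _ => ?_
    have hWm := hW m'
    rw [ha, norm_div, Complex.norm_real, Real.norm_eq_abs, abs_of_pos hWm]
    field_simp
  rw [k6] at k5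
  -- (6) `L² ≤ (θ²+2)·R·L`
  have k7 : L * L ≤ (θ ^ 2 + 2) * R * L := by
    have h1 : L ^ 2 ≤ (∑ m ∈ S, ‖z m‖ * ‖(∫ x in (-(1 / 2) : ℝ)..(1 / 2 : ℝ), (Complex.exp (((2 * Real.pi * b * θ * triWave x : ℝ) : ℂ) * Complex.I) * (∑ m' ∈ S', a m' * Complex.exp ((2 * Real.pi * (α + m') * x : ℝ) * Complex.I))) * Complex.exp (-(2 * Real.pi * (α + m) * x : ℝ) * Complex.I))‖) ^ 2 := pow_le_pow_left₀ hL0 k3 2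
    have h2 : R * ∑ m ∈ S, ((α + m) ^ 2 + b ^ 2) * ‖(∫ x in (-(1 / 2) : ℝ)..(1 / 2 : ℝ), (Complex.exp (((2 * Real.pi * b * θ * triWave x : ℝ) : ℂ) * Complex.I) * (∑ m' ∈ S', a m' * Complex.exp ((2 * Real.pi * (α + m') * x : ℝ) * Complex.I))) * Complex.exp (-(2 * Real.pi * (α + m) * x : ℝ) * Complex.I))‖ ^ 2 ≤ R * ((θ ^ 2 + 2) * L) := mul_le_mul_of_nonneg_left k5 hR0
    nlinarith [h1, k4, h2]
  rcases eq_or_lt_of_le hL0 with h | h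
  · rw [← h]; positivity
  · exact le_of_mul_le_mul_right k7 h

end Summit.AnomalousDissipation.AnomalousDissipation.Theorems.SawtoothPulseCascade.K2PhaseBudget
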